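import Mathlib
import HarnessLib
import Literature.Analysis.FluidPDE.TypeIAncientMild
import Literature.Analysis.FluidPDE.MildSolutionProofs
import Literature.Analysis.FluidPDE.OseenSliceFarField
import Literature.Analysis.FluidPDE.OseenDuhamelPairCalculus
import Literature.Analysis.FluidPDE.AxisymmetricEuler
import Literature.Analysis.FluidPDE.SelfSimilar
import Literature.Analysis.FluidPDE.EulerTimeScaling
import Summits.NavierStokesRegularity.NavierStokesRegularity.Theses.SymmetryModuliCount
import Summits.NavierStokesRegularity.NavierStokesRegularity.Theorems.SqueezeCycleExtremalElementExistsExtraction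
import Summits.NavierStokesRegularity.NavierStokesRegularity.Theorems.AxisTwistDoorTiltDominationLocSymmetryExclusions
import Summits.NavierStokesRegularity.NavierStokesRegularity.Theorems.SymmetryModuliCountFarPastLedgerReduction
import Summits.NavierStokesRegularity.NavierStokesRegularity.Theorems.ScenarioCensusPeriodicGauge
import Summits.NavierStokesRegularity.NavierStokesRegularity.Theorems.ExtremalTypeIConstantSmallConstantLiouville

/-!
# Census row A13, candidate cell A13isq-T (ONE discrete screw of IRRATIONAL turn) — LINE «screw-blowdown» port, part 1/12:
# objects, the cell `Row_A13isqT`, the obligation Props S1/S2/S3, S1 `SyndeticReturn` PROVED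

Re-homed for the scenario census (typer seat ns-census-typer-1 g7; lead g9 RULINGS [7] 20:33Z / [8] 21:03Z / [12](b) 21:58Z: «screw-blowdown v1.8 =
version of record; `Row_A13isqT` DECIDED IN KERNEL → CANDIDATE-DECIDED member under A13 (row already TREE); typer-1 slot 3 port of record =
`ScrewBlowdown_port_v1_8.lean` bb5f719a8be448dd (stub-free)»; critic idea-crit-3 g6 CONFORMS ×3 21:38:50Z; ref PRE-CHECKs items 13 / 15 / 20):
VERBATIM PORT of ns-idea-4 LINE g12-1 «screw-blowdown» PORT copy `pub/ideators/ns-idea-4/lines/screw-blowdown/port/ScrewBlowdown_port_v1_8.lean`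
sha16 bb5f719a8be448dd (2660 l.; lean check rc 0, 0 sorry; = the v1.7 port copy 674e939b7b0b34e8 as a literal prefix + the `LocalPersistence`
attack appendix `…LP` + the consequences `localPersistence_holds` / `farPastSpreading_holds` / `linearConeLiouville_holds` / `row_A13isqT_proved`),
split for the 400-line rule into `ScenarioCensusScrewBlowdown` (§1–§3: objects, the cell `Row_A13isqT`, obligation Props, S1 PROVED) →
`…Plumbing` (§4, S2 PROVED) → `…Bridges` (§5 + v1.3) → `…Recurrent` (v1.4, `Row_ArecT`) → `…OffAxis` (v1.5 a) → `…Cone` (v1.5 b: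
`farPast_linearCone_smallness_of_screw`) → `…Residual` (v1.5 c + v1.6: `LinearConeLiouville`, DSS rungs) → `…Propagation` (v1.7: FS, LP,
reductions; the three class-general tools are NOT re-declared — taken BY NAME, general `E`, from `Theorems/TypeIAncientMildForwardUniqueness.lean`,
ns-idea-4 extract a1b589f6dec7da83, p671177) → `…LPTools` / `…LPDuhamel` / `…LP` (the appendix: Gaussian locality, the three-term Oseen split,
time weights; `duhamel_bound`; the bootstrap `one_step` / `persist` / `localPersistence` + the consequences incl. `row_A13isqT_proved`) →
`…Keys` (census keys).  Lean text VERBATIM in namespaces `…Theorems.ScenarioCensus.ScrewBlowdown` / `…ScrewBlowdownLP` (the line's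
`…Lines.ScrewBlowdownPort` / `…PortLP` re-homed; qualified references renamed accordingly); port edits: `local notation "E3"` → `abbrev E3` (the
appendix `open`s it), `@[conjecture]` on the two Props still OPEN in this copy (`Row_ArecT`, `VanishingBlowdownLiouville`; v1.9 proves them
files-only, not of record here), four one-line docstrings added, the line's `set_option linter.unusedVariables false` dropped (five proof lambdas
bind the unused `θ₀ h` as `_ _`; the unused hypothesis binder of `hasVanishingBlowdown_of_axiallyRecurrent` is spelled `_hu`, statement otherwise
identical); `set_option maxHeartbeats … in` of the appendix kept as in the line.

No census VALUE is moved by this file (row A13 is TREE already; the lead books the member A13isq-T); NS regularity is NOT proved; (L′)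
`SymmetryModuliCount.TypeIAncientLiouville` is untouched (hypothesis of bridges only); no summit statement is proved by this file.
-/

-- the summit and its single problem share the name `NavierStokesRegularity` (D-0017 nested layout)
set_option linter.dupNamespace false

namespace Summit.NavierStokesRegularity.NavierStokesRegularity.Theorems.ScenarioCensus.ScrewBlowdown

open Set Function Filter Topology
open Literature.Analysis Literature.Analysis.FluidPDE
open Summit.NavierStokesRegularity.NavierStokesRegularity.Theorems

/-- `ℝ³` (the line's `local notation "E3"`, spelled as a reducible abbreviation for the tree). -/
abbrev E3 := EuclideanSpace ℝ (Fin 3)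

/-! ## §1 Objects -/

/-- Slicewise equivariance under the screw motion `x ↦ R_θ x + h e₃` (same phrasing as the sibling row
`Row_AsqT` of line «rotation-order»). -/
def IsScrewEquivariant (θ h : ℝ) (u : ℝ → E3 → E3) : Prop :=
  ∀ t < (0 : ℝ), ∀ x : E3, u t (rotZ θ x + h • eZ) = rotZ θ (u t x)

/-- Invariance under the whole CYLINDER GROUP `S¹ × ℝ` (all rotations about the axis and all axial
translations): the symmetry the blow-down acquires. -/
def IsCylinderInvariant (W : ℝ → E3 → E3) : Prop :=
  ∀ (φ s t : ℝ), t < 0 → ∀ x : E3, W t (rotZ φ x + s • eZ) = rotZ φ (W t x)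

/-- `W` is a BLOW-DOWN LIMIT of `u` in the class `A_C`: `W ∈ A_C` and, along some sequence of scales
`μ_k → +∞`, the parabolic zooms `nsRescale μ_k u = μ_k u(μ_k² t, μ_k x)` converge to `W` locally uniformly on every
negative time slice (the mode of convergence delivered by the tree extraction theorem). -/
def IsBlowdownLimit (C : ℝ) (u W : ℝ → E3 → E3) : Prop :=
  IsTypeIAncientMild C W ∧
    ∃ μ : ℕ → ℝ, (∀ k, 0 < μ k) ∧ Tendsto μ atTop atTop ∧
      ∀ t < (0 : ℝ), TendstoLocallyUniformly (fun k => nsRescale (μ k) u t) (W t) atTop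

/-- Every blow-down limit of `u` in `A_C` vanishes («trivial α-limit of the similarity flow»). -/
def HasVanishingBlowdown (C : ℝ) (u : ℝ → E3 → E3) : Prop :=
  ∀ W, IsBlowdownLimit C u W → ∀ t < (0 : ℝ), ∀ x, W t x = 0

/-- **Row A13isq-T** (proposed census cell): Type-I ancient mild (KNSS gauge, time rate only) + every slice
equivariant under ONE screw of IRRATIONAL turn `θ₀` (`θ₀/2π ∉ ℚ`) and axial drift `h ≠ 0` ⇒ `u ≡ 0` on `t < 0`.
[conjecture — this line's target; strict sub-cell of (L′)] -/
def Row_A13isqT : Prop :=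
  ∀ (C : ℝ) (u : ℝ → E3 → E3) (θ₀ h : ℝ), IsTypeIAncientMild C u → Irrational (θ₀ / (2 * Real.pi)) →
    h ≠ 0 → IsScrewEquivariant θ₀ h u → ∀ t < (0 : ℝ), ∀ x, u t x = 0

/-! ## §2 Obligations (Props) -/

/-- S1 · UNIFORM RECURRENCE of the irrational rotation (syndetic return times, uniform in the target angle):
for every `δ > 0` there is a window length `N` such that for every angle `φ` and every `m : ℤ` some
`n ∈ [m, m + N)` has `|nθ₀ − 2πk − φ| < δ` for a suitable `k : ℤ`. [classical: Kronecker/Weyl] -/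
def SyndeticReturn : Prop :=
  ∀ θ₀ : ℝ, Irrational (θ₀ / (2 * Real.pi)) → ∀ δ > (0 : ℝ), ∃ N : ℕ, 0 < N ∧
    ∀ (φ : ℝ) (m : ℤ), ∃ n : ℤ, m ≤ n ∧ n < m + N ∧ ∃ k : ℤ, |(n : ℝ) * θ₀ - (k : ℝ) * (2 * Real.pi) - φ| < δ

/-- S2 · BLOW-DOWN ENHANCEMENT (the new lemma): every blow-down limit of an irrational-screw-equivariant class
element is invariant under the whole cylinder group. -/
def BlowdownEnhancement : Prop :=
  ∀ (C : ℝ) (u : ℝ → E3 → E3) (θ₀ h : ℝ), IsTypeIAncientMild C u → Irrational (θ₀ / (2 * Real.pi)) →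
    h ≠ 0 → IsScrewEquivariant θ₀ h u → ∀ W, IsBlowdownLimit C u W → IsCylinderInvariant W

/-- S3 · VANISHING-BLOW-DOWN LIOUVILLE (research residual, NO symmetry): a Type-I ancient mild field all of whose
blow-down limits in its class vanish is identically zero («trivial α-limit ⇒ trivial orbit»). -/
@[conjecture] def VanishingBlowdownLiouville : Prop :=
  ∀ (C : ℝ) (u : ℝ → E3 → E3), IsTypeIAncientMild C u → HasVanishingBlowdown C u → ∀ t < (0 : ℝ), ∀ x, u t x = 0

/-! ## §3 Registered stubs (v1.2: S1 PROVED below, S2 PROVED after §4; the ONLY sorry of the file is S3) -/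

/-! ### S1 — PROVED (v1.1): Dirichlet (`Real.exists_int_int_abs_mul_sub_le`) + irrationality give a small non-zero
combination `qθ₀ − 2πp`; sweeping by its multiples gives the UNIFORM return window. -/

/-- Sweep: the multiples `jη`, `0 ≤ j ≤ T/η`, of a step `0 < η` form an `η`-net of `ℝ/Tℤ`. -/
theorem sweep {T η : ℝ} (hT : 0 < T) (hη : 0 < η) (ψ : ℝ) :
    ∃ j : ℕ, (j : ℝ) ≤ T / η ∧ ∃ k : ℤ, |(j : ℝ) * η - (k : ℝ) * T - ψ| < η := by
  set L : ℤ := ⌊ψ / T⌋ with hL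
  have hL1 : (L : ℝ) ≤ ψ / T := Int.floor_le (ψ / T)
  have hL2 : ψ / T < (L : ℝ) + 1 := Int.lt_floor_add_one (ψ / T)
  have hL1' : (L : ℝ) * T ≤ ψ := by rwa [le_div_iff₀ hT] at hL1
  have hL2' : ψ < ((L : ℝ) + 1) * T := by rwa [div_lt_iff₀ hT] at hL2
  set ψ' : ℝ := ψ - (L : ℝ) * T with hψ'
  have hψ'0 : 0 ≤ ψ' := by simp only [hψ']; linarith
  have hψ'T : ψ' < T := by simp only [hψ']; nlinarith
  set j : ℕ := ⌊ψ' / η⌋₊ with hj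
  have h1 : (j : ℝ) ≤ ψ' / η := Nat.floor_le (div_nonneg hψ'0 hη.le)
  have h2 : ψ' / η < (j : ℝ) + 1 := Nat.lt_floor_add_one _
  have h1' : (j : ℝ) * η ≤ ψ' := by rwa [le_div_iff₀ hη] at h1
  have h2' : ψ' < ((j : ℝ) + 1) * η := by rwa [div_lt_iff₀ hη] at h2
  refine ⟨j, h1.trans (div_le_div_of_nonneg_right hψ'T.le hη.le), -L, ?_⟩
  rw [abs_lt]; push_cast
  constructor <;> nlinarith

/-- A small NON-ZERO combination `qθ₀ - p·2π` (Dirichlet + irrationality of `θ₀/2π`). -/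
theorem small_nonzero_multiple {θ₀ : ℝ} (hirr : Irrational (θ₀ / (2 * Real.pi))) {δ : ℝ} (hδ : 0 < δ) :
    ∃ q : ℕ, 0 < q ∧ ∃ p : ℤ, (q : ℝ) * θ₀ - (p : ℝ) * (2 * Real.pi) ≠ 0 ∧
      |(q : ℝ) * θ₀ - (p : ℝ) * (2 * Real.pi)| < δ := by
  set T := 2 * Real.pi with hT
  have hTpos : 0 < T := by positivity
  obtain ⟨n, hn⟩ : ∃ n : ℕ, T / δ < n := exists_nat_gt (T / δ)
  have hnpos' : (0 : ℝ) < n := (div_pos hTpos hδ).trans hn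
  have hnpos : 0 < n := by exact_mod_cast hnpos'
  obtain ⟨j, k, hk0, hkn, hjk⟩ := Real.exists_int_int_abs_mul_sub_le (θ₀ / T) hnpos
  have hkcast : ((k.toNat : ℕ) : ℝ) = (k : ℝ) := by
    have : ((k.toNat : ℕ) : ℤ) = k := Int.toNat_of_nonneg hk0.le
    exact_mod_cast this
  have hscale : (k : ℝ) * θ₀ - (j : ℝ) * T = T * ((k : ℝ) * (θ₀ / T) - j) := by
    rw [mul_sub, mul_comm T ((k : ℝ) * (θ₀ / T)), mul_assoc, div_mul_cancel₀ θ₀ hTpos.ne', mul_comm T (j : ℝ)]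
  refine ⟨k.toNat, by omega, j, ?_, ?_⟩
  · rw [hkcast, hscale]
    intro h0
    have h0' : (k : ℝ) * (θ₀ / T) - j = 0 := by
      rcases mul_eq_zero.1 h0 with h | h
      · exact absurd h hTpos.ne'
      · exact h
    have hirr' : Irrational ((k : ℝ) * (θ₀ / T)) := hirr.intCast_mul (by omega : k ≠ 0)
    exact hirr'.ne_int j (by linarith)
  · rw [hkcast, hscale, abs_mul, abs_of_pos hTpos]
    have hTδ : T < δ * n := by
      have := hn; rw [div_lt_iff₀ hδ] at this; linarith
    calc T * |(k : ℝ) * (θ₀ / T) - j| ≤ T * (1 / (n + 1)) := by gcongr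
      _ < δ := by
        rw [mul_one_div, div_lt_iff₀ (by positivity)]
        nlinarith

/-- S1 (S-sized, classical) — PROVED in v1.1 (the name `stub_` is kept so that the registered composition is unchanged). -/
theorem stub_syndeticReturn : SyndeticReturn := by
  intro θ₀ hirr δ hδ
  set T := 2 * Real.pi with hT
  have hTpos : 0 < T := by positivity
  obtain ⟨q, hq, p, hne, hsmall⟩ := small_nonzero_multiple hirr hδ
  set η := (q : ℝ) * θ₀ - (p : ℝ) * T with hη
  have hηpos : 0 < |η| := abs_pos.2 hne
  obtain ⟨J, hJ⟩ : ∃ J : ℕ, T / |η| ≤ J := exists_nat_ge _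
  refine ⟨J * q + 1, Nat.succ_pos _, fun φ m => ?_⟩
  -- the bookkeeping common to both signs
  have key : ∀ (j : ℕ) (k' : ℤ) (σ : ℝ), (σ = 1 ∨ σ = -1) → (j : ℝ) ≤ T / |η| →
      |(j : ℝ) * (σ * η) - (k' : ℝ) * T - σ * (φ - (m : ℝ) * θ₀)| < σ * η →
      ∃ n : ℤ, m ≤ n ∧ n < m + ((J * q + 1 : ℕ) : ℤ) ∧
        ∃ k : ℤ, |(n : ℝ) * θ₀ - (k : ℝ) * (2 * Real.pi) - φ| < δ := by
    intro j k' σ hσ hjle hlt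
    have hjJ : j ≤ J := by
      have : (j : ℝ) ≤ J := hjle.trans hJ
      exact_mod_cast this
    have hjq : j * q ≤ J * q := Nat.mul_le_mul_right q hjJ
    refine ⟨m + ((j * q : ℕ) : ℤ), by omega, by push_cast; omega, ?_⟩
    have hση : σ * η ≤ |η| := by
      rcases hσ with rfl | rfl
      · simpa using le_abs_self η
      · simpa using neg_le_abs η
    have hηδ : |η| < δ := hsmall
    rcases hσ with rfl | rfl
    · refine ⟨(j : ℤ) * p + k', ?_⟩
      have : ((m + ((j * q : ℕ) : ℤ) : ℤ) : ℝ) * θ₀ - (((j : ℤ) * p + k' : ℤ) : ℝ) * (2 * Real.pi) - φ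
          = (j : ℝ) * (1 * η) - (k' : ℝ) * T - 1 * (φ - (m : ℝ) * θ₀) := by
        push_cast; simp only [hη, hT]; ring
      rw [this]; linarith
    · refine ⟨(j : ℤ) * p - k', ?_⟩
      have : ((m + ((j * q : ℕ) : ℤ) : ℤ) : ℝ) * θ₀ - (((j : ℤ) * p - k' : ℤ) : ℝ) * (2 * Real.pi) - φ
          = -((j : ℝ) * (-1 * η) - (k' : ℝ) * T - -1 * (φ - (m : ℝ) * θ₀)) := by
        push_cast; simp only [hη, hT]; ring
      rw [this, abs_neg]; linarith
  rcases lt_or_gt_of_ne (hne : η ≠ 0) with hneg | hpos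
  · have hη' : 0 < -1 * η := by linarith
    obtain ⟨j, hjle, k', hk'⟩ := sweep hTpos hη' (-1 * (φ - (m : ℝ) * θ₀))
    have habs : |η| = -1 * η := by rw [abs_of_neg hneg]; ring
    exact key j k' (-1) (Or.inr rfl) (by rwa [habs]) hk'
  · have hη' : 0 < 1 * η := by linarith
    obtain ⟨j, hjle, k', hk'⟩ := sweep hTpos hη' (1 * (φ - (m : ℝ) * θ₀))
    have habs : |η| = 1 * η := by rw [abs_of_pos hpos]; ring
    exact key j k' 1 (Or.inl rfl) (by rwa [habs]) hk'

/-! S2 `stub_blowdownEnhancement` — PROVED in v1.2, see the section after §4 (it uses the §4 plumbing). -/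

/-! S3 `VanishingBlowdownLiouville` is the line's RESEARCH residual: it is a `def` above and is NOT asserted in this
port-ready module (the ideator's line file carries it as the single sorried stub). -/

end Summit.NavierStokesRegularity.NavierStokesRegularity.Theorems.ScenarioCensus.ScrewBlowdown
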